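import Summits.AtomisticToContinuum.BoseEinsteinCondensation.Theorems.BECHeatBathGapSquareSummableInfluenceLeastSquares
import Summits.AtomisticToContinuum.BoseEinsteinCondensation.Theorems.BECConjugateDominationHardCoreExtensionMaxFormApproximationFiniteRangeBookkeeping
import HarnessLib

/-!
# Route `BECHeatBathGap`, crux `SquareSummableInfluence` (stmt-AtomisticToContinuum-14368), line `registered`:
# Bose symmetry turns the least-squares influence into a PAIR FACTORISATION through the bath state

Supports (does not close) stmt-AtomisticToContinuum-14368 (lead c6). The registered physics leaf of the line
(`stub_leastSquaresInfluence`, skeleton v4) asks that the fibrewise conditional least-squares defect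
`∫_{Λ^{N+1}} |Ψ − g⋆_i Θ(tail)|²` of the `(N+1)`-body state `Ψ` against the bath state `Θ` be small, summed over
the bath labels `i` (`g⋆_i` = orthogonal projection coefficient of `x_i ↦ Ψ` onto `ℂ Θ(tail Z^{i→·})` in
`L²(Λ, dx_i)`; lead c5). Leads c1–c5 never used that `Ψ` is BOSE SYMMETRIC between the inserted particle
`y = Z 0` and the bath particle `x_i = Z (succ i)`. With that symmetry the two commuting fibre projections onto
`ℂ θ_X̂` — in the variable `x_i` and in the variable `y`, `θ_X̂ = Θ(·, X̂)` the conditional one-particle amplitude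
of the bath state given the other `N − 1` bath particles `X̂` — have residuals of EQUAL norm, so projecting in both
variables costs at most twice the one-variable residual:

* `pairFactorisation_le_four_mul_leastSquares` — for measurable square-integrable `Θ`, `Ψ` with
  `Ψ ∘ swap(0, succ i) = Ψ` there is a measurable PAIR COEFFICIENT `c(Z) = c(X̂)`, blind to both `y` and `x_i`,
  with `∫_{Λ^{N+1}} |Ψ(Z) − c(Z) Θ(tail Z^{i→y}) Θ(tail Z)|² ≤ 4 ∫_{Λ^{N+1}} |Ψ − g⋆_i Θ(tail)|²`, i.e.
  `Ψ(y, x_i, X̂) ≈ c(X̂) θ_X̂(y) θ_X̂(x_i)`: conditioned on `N − 1` bath particles, the remaining PAIR of `Ψ` is in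
  the product of two copies of the bath state's conditional amplitude.

Sequel `…PairFactorisationLeaf.lean`: the converse (lead c5's lemma (A)), the equivalence of the registered stub
with its pair-factorisation form, and the crux by name. Hilbert-space geometry plus Tonelli on the box; `[folklore]`.
-/

noncomputable section

open MeasureTheory Filter Function
open scoped ENNReal NNReal Topology ComplexConjugate InnerProductSpace

namespace Summit.AtomisticToContinuum.BoseEinsteinCondensation.Theorems.SquareSummableInfluence

open Literature.MathematicalPhysics.QuantumManyBody.BoseGas

/-! ### Small tools -/

/-- **Cauchy–Schwarz**, mixed Bochner/Lebesgue form: `|∫ conj θ · R|² ≤ (∫|θ|²)(∫|R|²)` for `θ, R ∈ L²`.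
[folklore] -/
theorem norm_integral_conj_mul_sq_le {α : Type*} [MeasurableSpace α] {μ : Measure α} {θ R : α → ℂ}
    (hθ : MemLp θ 2 μ) (hR : MemLp R 2 μ) :
    ‖∫ x, conj (θ x) * R x ∂μ‖ ^ 2 ≤
      (∫⁻ x, (‖θ x‖₊ : ℝ≥0∞) ^ 2 ∂μ).toReal * (∫⁻ x, (‖R x‖₊ : ℝ≥0∞) ^ 2 ∂μ).toReal := by
  rw [← inner_toLp_eq_integral_conj_mul hR hθ, ← norm_toLp_sq_eq_toReal_lintegral hθ,
    ← norm_toLp_sq_eq_toReal_lintegral hR, ← mul_pow]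
  exact pow_le_pow_left₀ (norm_nonneg _) (norm_inner_le_norm _ _) 2

/-- Complex conjugation preserves `L²`. [folklore] -/
theorem memLp_two_conj {α : Type*} [MeasurableSpace α] {μ : Measure α} {g : α → ℂ} (hg : MemLp g 2 μ) :
    MemLp (fun x => conj (g x)) 2 μ :=
  (Complex.conjCLE.toContinuousLinearMap).comp_memLp' hg

/-- **Relabelling invariance of the box integral**: `∫_{Λ^n} G(Z ∘ σ) dZ = ∫_{Λ^n} G` for a permutation `σ` of the
labels and measurable `G ≥ 0` (Lebesgue measure and the box are relabelling invariant). [folklore] -/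
theorem setLIntegral_boxN_comp_perm {n : ℕ} (L : ℝ) (σ : Equiv.Perm (Fin n)) {G : Config n → ℝ≥0∞}
    (hG : Measurable G) :
    ∫⁻ Z in boxN n L, G (Z ∘ σ) = ∫⁻ Z in boxN n L, G Z := by
  have hmp := volume_measurePreserving_piCongrLeft (fun _ : Fin n => Space) σ.symm
  have h : ∀ X : Config n, (MeasurableEquiv.piCongrLeft (fun _ : Fin n => Space) σ.symm) X = X ∘ σ := by
    intro X
    funext j
    simp [MeasurableEquiv.piCongrLeft, Equiv.piCongrLeft_apply_eq_cast]
  have hmem : ∀ Z : Config n, Z ∘ σ ∈ boxN n L ↔ Z ∈ boxN n L := fun Z =>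
    ⟨fun hZ j => by simpa using hZ (σ.symm j), fun hZ j => hZ (σ j)⟩
  have hind : ∀ Z : Config n, (boxN n L).indicator G (Z ∘ σ) = (boxN n L).indicator (fun W => G (W ∘ σ)) Z := by
    intro Z
    by_cases hZ : Z ∈ boxN n L
    · rw [Set.indicator_of_mem hZ, Set.indicator_of_mem ((hmem Z).2 hZ)]
    · rw [Set.indicator_of_notMem hZ, Set.indicator_of_notMem (fun h' => hZ ((hmem Z).1 h'))]
  rw [← lintegral_indicator (measurableSet_boxN n L), ← lintegral_indicator (measurableSet_boxN n L)]
  have key := hmp.lintegral_comp (hG.indicator (measurableSet_boxN n L))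
  simp only [h, hind] at key
  exact key

/-- The transposition of the inserted particle with bath particle `i`, read on the bath side:
`tail (W ∘ swap(0, succ i)) = tail (W with W (succ i) ↦ W 0)`. [folklore] -/
theorem vecTail_comp_swap {N : ℕ} (i : Fin N) (W : Config (N + 1)) :
    Matrix.vecTail (W ∘ Equiv.swap (0 : Fin (N + 1)) (Fin.succ i)) =
      Matrix.vecTail (update W (Fin.succ i) (W 0)) := by
  funext j
  by_cases h : j = i
  · subst h; simp [Matrix.vecTail, Equiv.swap_apply_right]
  · have h' : Fin.succ j ≠ Fin.succ i := fun e => h (Fin.succ_injective _ e)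
    simp [Matrix.vecTail, update_of_ne h', Equiv.swap_apply_of_ne_of_ne (Fin.succ_ne_zero j) h']

/-- Resampling bath particle `i` after the transposition is resampling the inserted particle before it:
`(W ∘ swap(0, succ i)) with slot (succ i) ↦ x = (W with slot 0 ↦ x) ∘ swap(0, succ i)`. [folklore] -/
theorem update_comp_swap {N : ℕ} (i : Fin N) (W : Config (N + 1)) (x : Space) :
    update (W ∘ Equiv.swap (0 : Fin (N + 1)) (Fin.succ i)) (Fin.succ i) x =
      update W 0 x ∘ Equiv.swap (0 : Fin (N + 1)) (Fin.succ i) := by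
  funext k
  by_cases hk : k = Fin.succ i
  · subst hk; simp [Equiv.swap_apply_right]
  · by_cases hk0 : k = 0
    · subst hk0; simp [update_of_ne hk, Equiv.swap_apply_left]
    · simp [update_of_ne hk, Equiv.swap_apply_of_ne_of_ne hk0 hk, update_of_ne hk0]

/-- The tail ignores the inserted particle: `tail (W with slot 0 ↦ x) = tail W`. [folklore] -/
theorem vecTail_update_zero' {N : ℕ} (W : Config (N + 1)) (x : Space) :
    Matrix.vecTail (update W 0 x) = Matrix.vecTail W := by
  funext j
  simp [Matrix.vecTail]

/-! ### The pair factorisation -/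

/-- **Bose symmetry turns the least-squares influence into a pair factorisation.** Let `Θ : Λ_L^N → ℂ` (bath)
and `Ψ : Λ_L^{N+1} → ℂ` (bath plus the inserted particle `y = Z 0`) be measurable and square integrable on the
boxes, `i` a bath label, and suppose `Ψ` is symmetric under the transposition of the inserted particle with bath
particle `i` (`Ψ ∘ swap(0, succ i) = Ψ`, e.g. `Ψ` Bose symmetric). Then there is a measurable PAIR COEFFICIENT
`c`, blind to both `y = Z 0` and `x_i = Z (succ i)` (a function of the other `N − 1` bath particles `X̂` only),
such that
`∫_{Λ_L^{N+1}} |Ψ(Z) − c(Z) Θ(tail Z^{i→y}) Θ(tail Z)|² dZ ≤ 4 ∫_{Λ_L^{N+1}} |Ψ(Z) − g⋆_i(Z) Θ(tail Z)|² dZ`,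
where `g⋆_i(Z) = ∫_Λ conj Θ(tail Z^{i→x}) Ψ(Z^{i→x}) dx / ∫_Λ |Θ(tail Z^{i→x})|² dx` is the conditional least-squares
predictor of lead c5 and `Θ(tail Z^{i→y}) = θ_X̂(y)`, `Θ(tail Z) = θ_X̂(x_i)` are the two copies of the conditional
one-particle amplitude `θ_X̂ = Θ(·, X̂)` of the bath state. In words: if resampling ONE bath particle changes the
insertion amplitude little, then — conditioned on the other `N − 1` bath particles — the pair (inserted particle,
that bath particle) of `Ψ` is in the PRODUCT state `θ_X̂ ⊗ θ_X̂` up to four times that error. Proof: with the two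
commuting fibre projections `P_y`, `P_{x_i}` onto `ℂ θ_X̂`, `Ψ − P_y P_{x_i} Ψ = (1 − P_{x_i})Ψ + P_{x_i}(1 − P_y)Ψ`,
`‖P_{x_i}‖ ≤ 1` (Cauchy–Schwarz on the fibre) and `‖(1 − P_y)Ψ‖ = ‖(1 − P_{x_i})Ψ‖` (the transposition is a
measure-preserving relabelling exchanging the two projections); `|u + w|² ≤ 2|u|² + 2|w|²` (landed `nnnorm_add_sq_le`). The explicit
coefficient is `c(X̂) = m⁻¹ ∫_Λ conj θ_X̂(b) g⋆'(b, X̂) db`, `m = ∫_Λ |θ_X̂|²`, `g⋆'` the least-squares coefficient in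
the variable `y`. [folklore] -/
theorem pairFactorisation_le_four_mul_leastSquares :
    ∀ (N : ℕ) (L : ℝ) (Θ : Config N → ℂ) (Ψ : Config (N + 1) → ℂ), Measurable Θ → Measurable Ψ →
      (∫⁻ X in boxN N L, (‖Θ X‖₊ : ℝ≥0∞) ^ 2) ≠ ⊤ →
      (∫⁻ Z in boxN (N + 1) L, (‖Ψ Z‖₊ : ℝ≥0∞) ^ 2) ≠ ⊤ → ∀ (i : Fin N),
      (∀ Z : Config (N + 1), Ψ (Z ∘ Equiv.swap (0 : Fin (N + 1)) (Fin.succ i)) = Ψ Z) →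
    ∃ c : Config (N + 1) → ℂ, Measurable c ∧ (∀ Z a, c (Function.update Z 0 a) = c Z) ∧
      (∀ Z a, c (Function.update Z (Fin.succ i) a) = c Z) ∧
      (∫⁻ Z in boxN (N + 1) L, (‖Ψ Z -
          c Z * Θ (Matrix.vecTail (Function.update Z (Fin.succ i) (Z 0))) * Θ (Matrix.vecTail Z)‖₊ : ℝ≥0∞) ^ 2) ≤
      4 * ∫⁻ Z in boxN (N + 1) L, (‖Ψ Z -
        ((∫ x in box L, conj (Θ (Matrix.vecTail (Function.update Z (Fin.succ i) x))) *
            Ψ (Function.update Z (Fin.succ i) x)) /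
          (((∫⁻ x in box L, (‖Θ (Matrix.vecTail (Function.update Z (Fin.succ i) x))‖₊ : ℝ≥0∞) ^ 2).toReal
            : ℝ) : ℂ)) *
          Θ (Matrix.vecTail Z)‖₊ : ℝ≥0∞) ^ 2 := by
  intro N L Θ Ψ hΘ hΨ hΘ2 hΨ2 i hsymm
  -- notation: the transposition, the fibre maps, the fibrewise objects
  set σ : Equiv.Perm (Fin (N + 1)) := Equiv.swap (0 : Fin (N + 1)) (Fin.succ i) with hσ
  set μ : Fin (N + 1) → Measure Space := fun _ => (volume : Measure Space).restrict (box L) with hμ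
  have hU : Measurable fun p : Config (N + 1) × Space => Function.update p.1 (Fin.succ i) p.2 :=
    measurable_update'
  have hU0 : Measurable fun p : Config (N + 1) × Space => Function.update p.1 0 p.2 :=
    measurable_update'
  set θt : Config (N + 1) × Space → ℂ := fun p => Θ (Matrix.vecTail (Function.update p.1 (Fin.succ i) p.2))
    with hθt
  set ψt : Config (N + 1) × Space → ℂ := fun p => Ψ (Function.update p.1 (Fin.succ i) p.2) with hψt
  set ψt0 : Config (N + 1) × Space → ℂ := fun p => Ψ (Function.update p.1 0 p.2) with hψt0
  have hθtm : Measurable θt := hΘ.comp (measurable_vecTail.comp hU)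
  have hψtm : Measurable ψt := hΨ.comp hU
  have hψt0m : Measurable ψt0 := hΨ.comp hU0
  set m : Config (N + 1) → ℝ≥0∞ := fun Z => ∫⁻ x in box L, (‖θt (Z, x)‖₊ : ℝ≥0∞) ^ 2 with hm
  set o : Config (N + 1) → ℂ := fun Z => ∫ x in box L, conj (θt (Z, x)) * ψt (Z, x) with ho
  set gs : Config (N + 1) → ℂ := fun Z => o Z / (((m Z).toReal : ℝ) : ℂ) with hgs
  set o' : Config (N + 1) → ℂ := fun Z => ∫ x in box L, conj (θt (Z, x)) * ψt0 (Z, x) with ho'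
  set gs' : Config (N + 1) → ℂ := fun Z => o' Z / (((m Z).toReal : ℝ) : ℂ) with hgs'
  set c : Config (N + 1) → ℂ := fun Z =>
    (∫ b in box L, conj (θt (Z, b)) * gs' (Function.update Z (Fin.succ i) b)) / (((m Z).toReal : ℝ) : ℂ)
    with hc
  -- measurability
  have hmm : Measurable m := (hθtm.nnnorm.coe_nnreal_ennreal.pow_const 2).lintegral_prod_right'
  have hconjθ : Measurable fun p : Config (N + 1) × Space => conj (θt p) :=
    Complex.continuous_conj.measurable.comp hθtm
  have hom : Measurable o :=
    ((hconjθ.mul hψtm).stronglyMeasurable.integral_prod_right'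
      (ν := (volume : Measure Space).restrict (box L))).measurable
  have ho'm : Measurable o' :=
    ((hconjθ.mul hψt0m).stronglyMeasurable.integral_prod_right'
      (ν := (volume : Measure Space).restrict (box L))).measurable
  have hmR : Measurable fun Z => (((m Z).toReal : ℝ) : ℂ) := Complex.measurable_ofReal.comp hmm.ennreal_toReal
  have hgsm : Measurable gs := hom.div hmR
  have hgs'm : Measurable gs' := ho'm.div hmR
  have hcm : Measurable c :=
    ((hconjθ.mul (hgs'm.comp hU)).stronglyMeasurable.integral_prod_right'
      (ν := (volume : Measure Space).restrict (box L))).measurable.div hmR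
  -- elementary identities of the fibre maps
  have h0ne : (0 : Fin (N + 1)) ≠ Fin.succ i := (Fin.succ_ne_zero i).symm
  have hθt_i : ∀ Z y x, θt (Function.update Z (Fin.succ i) y, x) = θt (Z, x) := fun Z y x => by
    simp only [hθt, Function.update_idem]
  have hθt_0 : ∀ Z y x, θt (Function.update Z 0 y, x) = θt (Z, x) := fun Z y x => by
    simp only [hθt]
    rw [Function.update_comm h0ne, vecTail_update_zero']
  have hm_i : ∀ Z y, m (Function.update Z (Fin.succ i) y) = m Z := fun Z y => by
    simp only [hm, hθt_i]
  have hm_0 : ∀ Z y, m (Function.update Z 0 y) = m Z := fun Z y => by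
    simp only [hm, hθt_0]
  have ho_i : ∀ Z y, o (Function.update Z (Fin.succ i) y) = o Z := fun Z y => by
    simp only [ho, hθt, hψt, Function.update_idem]
  have ho'_0 : ∀ Z y, o' (Function.update Z 0 y) = o' Z := fun Z y => by
    simp only [ho', hθt_0]
    simp only [hψt0, Function.update_idem]
  have hgs_i : ∀ Z y, gs (Function.update Z (Fin.succ i) y) = gs Z := fun Z y => by
    simp only [hgs, hm_i, ho_i]
  have hgs'_0 : ∀ Z y, gs' (Function.update Z 0 y) = gs' Z := fun Z y => by
    simp only [hgs', hm_0, ho'_0]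
  have hc_i : ∀ Z y, c (Function.update Z (Fin.succ i) y) = c Z := fun Z y => by
    simp only [hc, hθt_i, hm_i, Function.update_idem]
  have hc_0 : ∀ Z y, c (Function.update Z 0 y) = c Z := fun Z y => by
    simp only [hc, hθt_0, hm_0]
    congr 1
    refine integral_congr_ae (ae_of_all _ fun b => ?_)
    simp only
    rw [Function.update_comm h0ne, hgs'_0]
  refine ⟨c, hcm, hc_0, hc_i, ?_⟩
  -- the empty box
  rcases le_or_gt L 0 with hL | hL
  · simp [boxN_succ_eq_empty_of_nonpos hL]
  have hL3 : ENNReal.ofReal L ^ 3 ≠ 0 := pow_ne_zero _ (by simpa using hL)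
  have hL3' : ENNReal.ofReal L ^ 3 ≠ ⊤ := ENNReal.pow_ne_top ENNReal.ofReal_ne_top
  -- the three players: `A = (1 − P_{x_i})Ψ`, `B = P_{x_i}(1 − P_y)Ψ`, `A' = (1 − P_y)Ψ`
  have hΘt : Measurable fun Z : Config (N + 1) => Θ (Matrix.vecTail Z) := hΘ.comp measurable_vecTail
  have hθ0m : Measurable fun Z : Config (N + 1) => θt (Z, Z 0) :=
    hθtm.comp (measurable_id.prodMk (measurable_pi_apply 0))
  set A : Config (N + 1) → ℂ := fun Z => Ψ Z - gs Z * Θ (Matrix.vecTail Z) with hA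
  set B : Config (N + 1) → ℂ := fun Z => (gs Z - c Z * θt (Z, Z 0)) * Θ (Matrix.vecTail Z) with hB
  set A' : Config (N + 1) → ℂ := fun Z => Ψ Z - gs' Z * θt (Z, Z 0) with hA'
  have hAm : Measurable A := hΨ.sub (hgsm.mul hΘt)
  have hBm : Measurable B := (hgsm.sub (hcm.mul hθ0m)).mul hΘt
  have hA'm : Measurable A' := hΨ.sub (hgs'm.mul hθ0m)
  set D : ℝ≥0∞ := ∫⁻ Z in boxN (N + 1) L, (‖A Z‖₊ : ℝ≥0∞) ^ 2 with hD
  set E : ℝ≥0∞ := ∫⁻ Z in boxN (N + 1) L, (‖B Z‖₊ : ℝ≥0∞) ^ 2 with hE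
  -- Step 1: `D ≤ ∫ |Ψ|² < ⊤` (the least-squares predictor beats `g = 0`)
  have hDfin : D ≠ ⊤ := by
    have h := lintegral_sub_leastSquares_mul_tail_sq_le N L Θ Ψ hΘ hΨ hΘ2 hΨ2 i (fun _ => 0)
      measurable_const (fun _ _ => rfl)
    simp only [zero_mul, sub_zero] at h
    exact ne_top_of_le_ne_top hΨ2 h
  -- Step 2: `A' = A ∘ swap`, hence `∫ |A'|² = D`
  have hA'A : ∀ W, A' W = A (W ∘ σ) := by
    intro W
    have hθσ : ∀ x, θt (W ∘ σ, x) = θt (W, x) := fun x => by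
      simp only [hθt, hσ]
      rw [update_comp_swap, vecTail_comp_swap]
      simp only [Function.update_self]
      rw [show Function.update (Function.update W 0 x) (Fin.succ i) x =
          Function.update (Function.update W (Fin.succ i) x) 0 x from Function.update_comm h0ne _ _ _,
        vecTail_update_zero']
    have hmσ : m (W ∘ σ) = m W := by simp only [hm, hθσ]
    have hoσ : o (W ∘ σ) = o' W := by
      simp only [ho, ho', hθσ]
      refine integral_congr_ae (ae_of_all _ fun x => ?_)
      simp only [hψt, hψt0, hσ]
      rw [update_comp_swap, hsymm]
    have hgsσ : gs (W ∘ σ) = gs' W := by simp only [hgs, hgs', hmσ, hoσ]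
    have htail : Θ (Matrix.vecTail (W ∘ σ)) = θt (W, W 0) := by
      simp only [hθt, hσ, vecTail_comp_swap]
    simp only [hA, hA', hgsσ, htail, hsymm]
  have hD' : ∫⁻ Z in boxN (N + 1) L, (‖A' Z‖₊ : ℝ≥0∞) ^ 2 = D := by
    simp only [hA'A]
    exact setLIntegral_boxN_comp_perm L σ (G := fun Z => (‖A Z‖₊ : ℝ≥0∞) ^ 2)
      (hAm.nnnorm.coe_nnreal_ennreal.pow_const 2)
  -- Step 3: a.e. fibre of `x_i` has finite `Θ`-mass, finite `Ψ`-mass and finite `A'`-mass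
  have hm_eq : (∫⋯∫⁻_{Fin.succ i}, (fun Z => (‖Θ (Matrix.vecTail Z)‖₊ : ℝ≥0∞) ^ 2) ∂μ) = m := by
    rw [lmarginal_singleton]
  have hm_ae : ∀ᵐ Z ∂(volume : Measure (Config (N + 1))).restrict (boxN (N + 1) L), m Z < ⊤ := by
    refine ae_lt_top hmm ?_
    rw [← hm_eq, setLIntegral_boxN_lmarginal_singleton (N + 1) L (Fin.succ i)
      (hΘt.nnnorm.coe_nnreal_ennreal.pow_const 2), setLIntegral_boxN_succ_comp_vecTail L
      (hΘ.nnnorm.coe_nnreal_ennreal.pow_const 2)]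
    exact ENNReal.mul_ne_top hL3' (ENNReal.mul_ne_top hL3' hΘ2)
  set pm : Config (N + 1) → ℝ≥0∞ := fun Z => ∫⁻ x in box L, (‖ψt (Z, x)‖₊ : ℝ≥0∞) ^ 2 with hpm
  have hpmm : Measurable pm := (hψtm.nnnorm.coe_nnreal_ennreal.pow_const 2).lintegral_prod_right'
  have hp_eq : (∫⋯∫⁻_{Fin.succ i}, (fun Z => (‖Ψ Z‖₊ : ℝ≥0∞) ^ 2) ∂μ) = pm := by
    rw [lmarginal_singleton]
  have hp_ae : ∀ᵐ Z ∂(volume : Measure (Config (N + 1))).restrict (boxN (N + 1) L), pm Z < ⊤ := by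
    refine ae_lt_top hpmm ?_
    rw [← hp_eq, setLIntegral_boxN_lmarginal_singleton (N + 1) L (Fin.succ i)
      (hΨ.nnnorm.coe_nnreal_ennreal.pow_const 2)]
    exact ENNReal.mul_ne_top hL3' hΨ2
  set R : Config (N + 1) × Space → ℂ := fun p => A' (Function.update p.1 (Fin.succ i) p.2) with hR
  have hRm : Measurable R := hA'm.comp hU
  set rm : Config (N + 1) → ℝ≥0∞ := fun Z => ∫⁻ x in box L, (‖R (Z, x)‖₊ : ℝ≥0∞) ^ 2 with hrm
  have hrmm : Measurable rm := (hRm.nnnorm.coe_nnreal_ennreal.pow_const 2).lintegral_prod_right'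
  have hr_eq : (∫⋯∫⁻_{Fin.succ i}, (fun Z => (‖A' Z‖₊ : ℝ≥0∞) ^ 2) ∂μ) = rm := by
    rw [lmarginal_singleton]
  have hr_ae : ∀ᵐ Z ∂(volume : Measure (Config (N + 1))).restrict (boxN (N + 1) L), rm Z < ⊤ := by
    refine ae_lt_top hrmm ?_
    rw [← hr_eq, setLIntegral_boxN_lmarginal_singleton (N + 1) L (Fin.succ i)
      (hA'm.nnnorm.coe_nnreal_ennreal.pow_const 2), hD']
    exact ENNReal.mul_ne_top hL3' hDfin
  -- Step 4: Cauchy–Schwarz on every good fibre: `|gs − c θ(y)|² · m ≤ ∫ |A'(Z^{i→b})|² db`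
  have hfib : ∀ᵐ Z ∂(volume : Measure (Config (N + 1))).restrict (boxN (N + 1) L),
      (‖gs Z - c Z * θt (Z, Z 0)‖₊ : ℝ≥0∞) ^ 2 * m Z ≤ rm Z := by
    filter_upwards [hm_ae, hp_ae, hr_ae] with Z hmZ hpZ hrZ
    rcases eq_or_ne (m Z) 0 with hm0 | hm0
    · rw [hm0, mul_zero]
      exact bot_le
    -- the fibre functions and their square integrability
    have hθL : MemLp (fun x => θt (Z, x)) 2 ((volume : Measure Space).restrict (box L)) :=
      memLp_two_of_lintegral_ne_top (hθtm.comp measurable_prodMk_left).aestronglyMeasurable hmZ.ne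
    have hψL : MemLp (fun x => ψt (Z, x)) 2 ((volume : Measure Space).restrict (box L)) :=
      memLp_two_of_lintegral_ne_top (hψtm.comp measurable_prodMk_left).aestronglyMeasurable hpZ.ne
    have hRL : MemLp (fun x => R (Z, x)) 2 ((volume : Measure Space).restrict (box L)) :=
      memLp_two_of_lintegral_ne_top (hRm.comp measurable_prodMk_left).aestronglyMeasurable hrZ.ne
    have hθcL := memLp_two_conj hθL
    have hint1 : Integrable (fun x => conj (θt (Z, x)) * ψt (Z, x)) ((volume : Measure Space).restrict (box L)) :=
      hθcL.integrable_mul hψL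
    have hint2 : Integrable (fun x => conj (θt (Z, x)) * R (Z, x)) ((volume : Measure Space).restrict (box L)) :=
      hθcL.integrable_mul hRL
    -- `gs' (Z^{i→b}) θ(y) = ψt b − R b` on the fibre
    have hRb : ∀ b, gs' (Function.update Z (Fin.succ i) b) * θt (Z, Z 0) = ψt (Z, b) - R (Z, b) := by
      intro b
      have hθy : θt (Function.update Z (Fin.succ i) b, Function.update Z (Fin.succ i) b 0) = θt (Z, Z 0) := by
        rw [Function.update_of_ne h0ne, hθt_i]
      simp only [hR, hA', hψt, hθy]
      ring
    -- the residual coefficient is `(∫ conj θ · R) / m`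
    have hkey : gs Z - c Z * θt (Z, Z 0) =
        (∫ b in box L, conj (θt (Z, b)) * R (Z, b)) / (((m Z).toReal : ℝ) : ℂ) := by
      have h1 : c Z * θt (Z, Z 0) =
          (∫ b in box L, conj (θt (Z, b)) * (ψt (Z, b) - R (Z, b))) / (((m Z).toReal : ℝ) : ℂ) := by
        simp only [hc]
        rw [div_mul_eq_mul_div, ← integral_mul_const]
        congr 1
        refine integral_congr_ae (ae_of_all _ fun b => ?_)
        simp only
        rw [mul_assoc, hRb]
      rw [h1, hgs, ho, ← sub_div]
      congr 1
      beta_reduce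
      have h3 : ∫ b in box L, conj (θt (Z, b)) * (ψt (Z, b) - R (Z, b)) =
          (∫ b in box L, conj (θt (Z, b)) * ψt (Z, b)) - ∫ b in box L, conj (θt (Z, b)) * R (Z, b) := by
        rw [← integral_sub hint1 hint2]
        refine integral_congr_ae (ae_of_all _ fun b => ?_)
        simp only
        ring
      rw [h3, sub_sub_cancel]
    -- Cauchy–Schwarz and the division by `m`
    have hCS := norm_integral_conj_mul_sq_le hθL hRL
    have hmpos : 0 < (m Z).toReal := ENNReal.toReal_pos hm0 hmZ.ne
    have hreal : ‖gs Z - c Z * θt (Z, Z 0)‖ ^ 2 * (m Z).toReal ≤ (rm Z).toReal := by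
      rw [hkey, norm_div, Complex.norm_real, Real.norm_of_nonneg hmpos.le, div_pow]
      rw [div_mul_eq_mul_div, pow_two (m Z).toReal, mul_div_mul_right _ _ hmpos.ne', div_le_iff₀ hmpos]
      calc ‖∫ b in box L, conj (θt (Z, b)) * R (Z, b)‖ ^ 2
          ≤ (m Z).toReal * (rm Z).toReal := hCS
        _ = (rm Z).toReal * (m Z).toReal := mul_comm _ _
    -- back to `ℝ≥0∞`
    have h2 : ((‖gs Z - c Z * θt (Z, Z 0)‖₊ : ℝ≥0∞)) ^ 2 * m Z =
        ENNReal.ofReal (‖gs Z - c Z * θt (Z, Z 0)‖ ^ 2 * (m Z).toReal) := by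
      rw [coe_nnnorm_sq_eq_ofReal, ENNReal.ofReal_mul (by positivity), ENNReal.ofReal_toReal hmZ.ne]
    rw [h2, ← ENNReal.ofReal_toReal hrZ.ne]
    exact ENNReal.ofReal_le_ofReal hreal
  -- Step 5: integrate the fibres: `E ≤ D`
  have hED : E ≤ D := by
    have hBsq : Measurable fun Z => (‖B Z‖₊ : ℝ≥0∞) ^ 2 := hBm.nnnorm.coe_nnreal_ennreal.pow_const 2
    have hA'sq : Measurable fun Z => (‖A' Z‖₊ : ℝ≥0∞) ^ 2 := hA'm.nnnorm.coe_nnreal_ennreal.pow_const 2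
    have hmargB : (∫⋯∫⁻_{Fin.succ i}, (fun Z => (‖B Z‖₊ : ℝ≥0∞) ^ 2) ∂μ) =
        fun Z => (‖gs Z - c Z * θt (Z, Z 0)‖₊ : ℝ≥0∞) ^ 2 * m Z := by
      funext Z
      rw [lmarginal_singleton]
      have hθy : ∀ x, θt (Function.update Z (Fin.succ i) x, Function.update Z (Fin.succ i) x 0) = θt (Z, Z 0) :=
        fun x => by rw [Function.update_of_ne h0ne, hθt_i]
      have hmeasx : Measurable fun x : Space =>
          (‖Θ (Matrix.vecTail (Function.update Z (Fin.succ i) x))‖₊ : ℝ≥0∞) ^ 2 :=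
        (hΘ.comp (measurable_vecTail.comp (measurable_update _))).nnnorm.coe_nnreal_ennreal.pow_const 2
      simp only [hB, hgs_i, hc_i, hθy, nnnorm_mul, ENNReal.coe_mul, mul_pow, hμ]
      rw [lintegral_const_mul _ hmeasx]
    rw [hE, ← ENNReal.mul_le_mul_iff_right hL3 hL3',
      ← setLIntegral_boxN_lmarginal_singleton (N + 1) L (Fin.succ i) hBsq, ← hD',
      ← setLIntegral_boxN_lmarginal_singleton (N + 1) L (Fin.succ i) hA'sq, hmargB, hr_eq]
    exact lintegral_mono_ae hfib
  -- Step 6: `|Ψ − c θ(y) θ(x_i)|² = |A + B|² ≤ 2|A|² + 2|B|²`, integrate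
  have hsplit : ∀ Z, Ψ Z - c Z * Θ (Matrix.vecTail (Function.update Z (Fin.succ i) (Z 0))) *
      Θ (Matrix.vecTail Z) = A Z + B Z := by
    intro Z
    simp only [hA, hB, hθt]
    ring
  simp only [hsplit]
  change ∫⁻ Z in boxN (N + 1) L, (‖A Z + B Z‖₊ : ℝ≥0∞) ^ 2 ≤ 4 * D
  calc ∫⁻ Z in boxN (N + 1) L, (‖A Z + B Z‖₊ : ℝ≥0∞) ^ 2
      ≤ ∫⁻ Z in boxN (N + 1) L, (2 * (‖A Z‖₊ : ℝ≥0∞) ^ 2 + 2 * (‖B Z‖₊ : ℝ≥0∞) ^ 2) :=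
        lintegral_mono fun Z =>
          Summit.AtomisticToContinuum.BoseEinsteinCondensation.Cruxes.HardCoreExtension.NearMinTower.nnnorm_add_sq_le _ _
    _ = 2 * D + 2 * E := by
        rw [lintegral_add_left ((hAm.nnnorm.coe_nnreal_ennreal.pow_const 2).const_mul _),
          lintegral_const_mul _ (hAm.nnnorm.coe_nnreal_ennreal.pow_const 2),
          lintegral_const_mul _ (hBm.nnnorm.coe_nnreal_ennreal.pow_const 2)]
    _ ≤ 2 * D + 2 * D := by gcongr
    _ = 4 * D := by rw [← add_mul]; norm_num

end Summit.AtomisticToContinuum.BoseEinsteinCondensation.Theorems.SquareSummableInfluence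

end
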